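import Summits.ABC.StewartYu.ArchG3StepPacks
import Summits.ABC.StewartYu.ArchG3LevelStepH
import Summits.ABC.StewartYu.ArchG3Output
import Summits.ABC.StewartYu.ArchG3Supply
import HarnessLib

/-!
# Cell abc-stewartyu, rung A1.L (crux r2 `ArchCoreRat`), WP-L.A: the SCHEDULE of the archimedean frame — the half-step record package, the
# level state, `(lev, n) → (lev+1, n)`, all levels, and the frame output from the last level (= the content of `stub_levelsArch`, R27)

`Summits/ABC/StewartYu/ArchG3Schedule.lean` — cell `abc-stewartyu` (HOME `run/shared/lean/pub/abc-stewartyu/`; TRANCHE PLAN v1.2 §4′ P-A5/P-A6;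
rulings R26(e), R27; seat lp-1 g8).  Definitions (`ArchHalfStepHypU` — the record package of one Kummer half-step, uniform over the unknown set
`U ⊇ B` and the box; `Lb` — the level boxes; `ArchLevelState` — the state at level `lev`) and theorems; no named fact; no numerics (every
inequality is a package the record `ArchG3Par` discharges).  Archimedean twin of `PadicG3StepPacks.HalfStepHypU`/`halfStep_of_hypU` and
`PadicG3Schedule` (`LevelState`, `levelUp`, `levels`, `frameOutput_of_levelState`; seat p2-g4):

* `ArchLvInv.halfStep_of_hypU` — the half-step from the uniform package (termwise integrality/size of `(Hasse_a Rᵢ)(s/2)·qEhZ w s`, uniform over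
  `i ∈ U` and the box; the class sums' denominator and total size are derived by `exists_int_mul_halfClassVec` / `sum_abs_halfClassVec_le_of_forall`);
* `ArchLevelState S H Sh s U pv P w cl el lev N T` — `∃ B v lo`, `B ⊆ U`, `v` injective in `λ = i.2` on `B`, and
  `ArchLvInv (Δ(2^{Ŝ−lev}Y₀; i.1, H)) B v pv lo (Lb s lev) P (wl lev) γ (cl lev) (el lev) {|x| ≤ N} T` with `|γ| ≤ γb lev` (slab radius `wl lev`,
  `wl (lev+1) = wl lev/2`, centre bound `γb (lev+1) ≥ wl lev/2` — print's `2^{−s}`; Δ-basis data `(cl, el)` chosen per level by the record);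
* `levelUp` — `(lev, n) → (lev+1, n)`: half-step (`Δ(2^{e+1}·)(s/2) = 2ᵃ Δ(2^e·)(s)`, `ArchSupply.hasse_scaledFeldR_half`), odd-node k-step,
  `n − 1` symmetric k-steps (`ArchLvInv.levelRun`); keeps `B ⊆ U`, the injectivity and the coefficient vector;
* `levelZeroRun` — the `n` k-steps of level `0` from the START state at `(0,0)`; `levels` — induction on the level;
  **`frameOutput_of_levelState`** — the last level's state gives `FrameOutputTwo n α b j₀ D₀ S₀ X′ (Lb s Ŝ)`
  (`ArchLvInv.frameOutputTwo` after `congr_R` to `feldR`), the shared place-free END input; **`frameOutput_of_schedule`** — all of it: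
  START state + packages ⇒ `FrameOutputTwo` (= `stub_levelsArch`).

WHAT THIS IS NOT: the START (level-`0` state, `stub_startArch`, seat p1), the records, the END; no crux moves.

## References
* Yu. V. Nesterenko, LNM 1819 (2003) — §4 Prop. 4.1, (4.1)–(4.7) p. 79–81, §4.2–4.3 p. 83–95, §5.1 p. 95–97. [Nesterenko2003]
* K. Yu, Acta Math. 211 (2013) — §§5–6 (the `p`-adic model). [Yu2013]
-/

noncomputable section

open Finset Polynomial
open Literature.NumberTheory.Transcendental
open Literature.NumberTheory.Transcendental.CW77 (heightProd)
open Literature.NumberTheory.Transcendental.CW77.Setup (Tau tauNorm)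
open Summit.ABC.StewartYu.FeldmanBasis (feldR natDegree_feldR_le)
open Summit.ABC.StewartYu.ArchSupply (scaledFeldR hasse_scaledFeldR_eval hasse_scaledFeldR_half)
open scoped Nat

namespace Summit.ABC.StewartYu

namespace ArchG3Setup

variable (S : ArchG3Setup) {ι : Type*}

/-! ### The record package of one half-step -/

/-- **Record package of one Kummer half-step** (`(s, n) → (s+1, 0)`: nodes `|x| ≤ N` → odd `|x| ≤ 2N₁ − 1`, orders `T → T′`, `Y₀`-weights
`R → R′`, Δ-basis `(c, e) → (c′, e′)`), uniform over `i ∈ U` and the box `|wⱼ| ≤ Lⱼ`; `δ₀ ≥ |Λ/b_{j₀}|`.  Termwise data: `Dh a s` clears and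
`Mt` bounds `(Hasse_a Rᵢ)(s/2)·qEhZ w s`; the class sums then have denominator `Dh a s` and total size `≤ 1 + #U·(P·DΔ)·Mt`.
[cite: Nesterenko2003, §4.3 (4.36)–(4.51), p. 90–95; shape only] -/
def ArchHalfStepHypU (R R' : ι → ℚ[X]) (U : Finset ι) (L : Fin S.n → ℕ) (P : ℤ) (w γb : ℝ) (c : ℤ) (e : Fin S.n → ℤ) (c' : ℤ)
    (δ₀ : ℝ) (N N₁ T T' : ℕ) : Prop :=
  ∃ (t : ℕ) (ca : ℕ → ℚ) (A Γ : Fin S.n → ℝ) (DΔ E Wd Wn Wh C Mt : ℝ) (Dh : ℕ → ℤ → ℕ),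
    1 ≤ t ∧ T' + t ≤ T ∧ 2 * N₁ ≤ 6 * N + 5 ∧ (∀ a, ca a ≠ 0) ∧
    (∀ i ∈ U, ∀ (a : ℕ) (s : ℤ), (hasseDeriv a (R i)).eval ((s : ℚ) / 2) = ca a * (hasseDeriv a (R' i)).eval (s : ℚ)) ∧ c' ≠ 0 ∧
    (∀ k, |S.lg k| ≤ A k) ∧ (∀ k, 0 ≤ Γ k) ∧
    (∀ w' : Fin S.n → ℤ, (∀ j, |w' j| ≤ (L j : ℤ)) → ∀ k, |(S.zγ w' k : ℝ)| ≤ Γ k) ∧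
    0 ≤ DΔ ∧
    (∀ w' : Fin S.n → ℤ, (∀ j, |w' j| ≤ (L j : ℤ)) → ∀ (a : ℕ) (μ : Fin S.n → ℕ), a + ∑ k, μ k < T' →
      |((∏ k, Ring.multichoose (S.yΔ c e w' k) (μ k) : ℤ) : ℝ)| ≤ DΔ) ∧
    1 ≤ E ∧
    (∀ i ∈ U, ∀ a < T', ∀ z : ℂ, ‖z‖ ≤ (3 * E + 1) * (2 * N + 1) + N → ‖(hw R i a).eval z‖ ≤ Wd) ∧
    0 ≤ Wn ∧ (∀ i ∈ U, ∀ t₀ < T, ∀ x : ℤ, |x| ≤ (N : ℤ) → |(((hasseDeriv t₀ (R i)).eval (x : ℚ) : ℚ) : ℝ)| ≤ Wn) ∧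
    0 ≤ Wh ∧ (∀ i ∈ U, ∀ a < T', ∀ s : ℤ, Odd s → |s| ≤ 2 * (N₁ : ℤ) - 1 → ‖(hw R i a).eval ((s : ℂ) / 2)‖ ≤ Wh) ∧
    0 ≤ w ∧ (L S.j₀ : ℝ) * δ₀ * (3 * N + 2) ≤ 1 ∧ 1 ≤ C ∧
    (∀ a s, 1 ≤ Dh a s) ∧
    (∀ a < T', ∀ s : ℤ, Odd s → |s| ≤ 2 * (N₁ : ℤ) - 1 → ∀ i ∈ U, ∀ w' : Fin S.n → ℤ, (∀ j, |w' j| ≤ (L j : ℤ)) →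
      ∃ z : ℤ, (Dh a s : ℚ) * ((hasseDeriv a (R i)).eval ((s : ℚ) / 2) * S.qEhZ w' s) = z) ∧
    0 ≤ Mt ∧
    (∀ a < T', ∀ s : ℤ, Odd s → |s| ≤ 2 * (N₁ : ℤ) - 1 → ∀ i ∈ U, ∀ w' : Fin S.n → ℤ, (∀ j, |w' j| ≤ (L j : ℤ)) →
      |(((hasseDeriv a (R i)).eval ((s : ℚ) / 2) * S.qEhZ w' s : ℚ) : ℝ)| ≤ Mt) ∧
    (∀ s : ℤ, Odd s → |s| ≤ 2 * (N₁ : ℤ) - 1 → ∀ (a : ℕ) (μ : Fin S.n → ℕ), a + ∑ k, μ k < T' →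
      Real.exp (γb * (3 * N + 2)) *
          (2 * ((2 * N + 1 : ℕ) : ℝ) ^ (t + 1) * t * (20 * Real.exp 1) ^ ((2 * N + 1) * t) *
              ((2 * C) ^ t * Real.exp (γb * (N + 1)) *
                ((2 : ℝ) ^ a * Real.exp ((∑ k, A k * Γ k) / C) *
                  (U.card * (P * DΔ) * Wn * Real.exp ((γb + w) * N) * (2 * ((L S.j₀ : ℝ) * δ₀ * N))))) +
            U.card * (P * DΔ) * Wd * Real.exp ((w + (L S.j₀ : ℝ) * δ₀) * ((3 * E + 1) * (2 * N + 1) + N)) * (1 / E) ^ ((2 * N + 1) * t)) +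
        U.card * (P * DΔ) * Wh * Real.exp ((γb + w) * (3 * N + 2)) * (2 * ((L S.j₀ : ℝ) * δ₀ * (3 * N + 2))) <
      (1 + U.card * (P * DΔ) * Mt) / (4 * (Dh a s : ℝ) * (1 + U.card * (P * DΔ) * Mt) * heightProd S.α ^ 2) ^ (2 ^ S.n))

namespace ArchLvInv

variable {S} {R R' : ι → ℚ[X]} {U B : Finset ι} {v : ι → Fin S.n → ℤ} {pv : ι → ℤ} {lo : Fin S.n → ℤ} {L : Fin S.n → ℕ} {P : ℤ}
  {w γ γb : ℝ} {c c' : ℤ} {e e' : Fin S.n → ℤ} {δ₀ : ℝ} {N N₁ T T' : ℕ}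

/-- **The half-step from the uniform package** (`B ⊆ U`, independent square classes, `|Λ/b_{j₀}| ≤ δ₀`).
[cite: Nesterenko2003, §4.3 (4.36)–(4.51), Lemma 4.4, p. 90–95] -/
theorem halfStep_of_hypU (hBU : B ⊆ U) (h : S.ArchLvInv R B v pv lo L P w γ c e {x : ℤ | |x| ≤ (N : ℤ)} T)
    (hind : ∀ T₁ : Finset (Fin S.n), T₁.Nonempty → ¬ IsSquare (∏ j ∈ T₁, S.α j))
    (hΛ : |S.Λ / (S.b S.j₀ : ℝ)| ≤ δ₀) (hγ : |γ| ≤ γb) (H : S.ArchHalfStepHypU R R' U L P w γb c e c' δ₀ N N₁ T T')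
    (e' : Fin S.n → ℤ) :
    ∃ i₀ ∈ B, pv i₀ ≠ 0 ∧
      S.ArchLvInv R' (S.parityClass v B i₀) (S.halfDiff v i₀) pv (fun j => -((v i₀ j - lo j) / 2)) (fun j => L j / 2) P (w / 2)
        ((γ - S.Lsum (v i₀)) / 2) c' e' {x : ℤ | Odd x ∧ |x| ≤ 2 * (N₁ : ℤ) - 1} T' := by
  obtain ⟨t, ca, A, Γ, DΔ, E, Wd, Wn, Wh, C, Mt, Dh, ht, hT, hN₁, hca, hRR', hc', hA, hΓ0, hΓ, hDΔ0, hDΔ, hE, hWd, hWn0, hWn,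
    hWh0, hWh, hw0, hsmall, hC, hDh, hint, hMt0, hMt, hfinal⟩ := H
  obtain ⟨i₁, hi₁B, _⟩ := h.nonzero
  have hBc : (B.card : ℝ) ≤ U.card := by exact_mod_cast card_le_card hBU
  have hP0 := h.P_nonneg
  have hPΔ : ∀ (a : ℕ) (μ : Fin S.n → ℕ), a + ∑ k, μ k < T' → ∀ i ∈ B, |(S.pvΔ v pv c e μ i : ℝ)| ≤ P * DΔ :=
    fun a μ haμ => h.abs_pvΔ_le_of_box fun w' hw' => hDΔ w' hw' a μ haμ
  -- the term `rHalf` at `τ = (a, 0)` is `(Hasse_a Rᵢ)(s/2) · qEhZ(vᵢ) s`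
  have hrHalf : ∀ (i : ι) (a : ℕ) (s : ℤ), S.rHalf R v i ((a, 0) : Tau S.n) s =
      (hasseDeriv a (R i)).eval ((s : ℚ) / 2) * S.qEhZ (v i) s := by
    intro i a s; simp [ArchG3Setup.rHalf]
  refine h.halfStep hind ht hT hN₁ ca hca (fun i hi => hRR' i (hBU hi)) hc' e' hBc hA hΓ0
    (fun i hi k => hΓ (v i) (h.abs_le i hi) k) (mul_nonneg hP0 hDΔ0) hPΔ hE (fun i hi => hWd i (hBU hi)) hWn0 (fun i hi => hWn i (hBU hi))
    hWh0 (fun i hi => hWh i (hBU hi)) hw0 hΛ hsmall hC (fun s a _μ => Dh a s) (fun s a _μ => hDh a s) ?_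
    (fun s a _μ => 1 + U.card * (P * DΔ) * Mt) (fun s a _μ => ?_) ?_ ?_
  · -- denominators of the class sums from the termwise integrality
    intro s hso hs a μ haμ T₁
    refine S.exists_int_mul_halfClassVec R v B _ _ s (fun i hi => ?_) T₁
    rw [hrHalf]
    exact hint a (by omega) s hso hs i (hBU hi) (v i) (h.abs_le i hi)
  · -- `1 ≤ Mb`
    have : 0 ≤ (U.card : ℝ) * (P * DΔ) * Mt := by positivity
    linarith
  · -- total size of the class sums from the termwise bound
    intro s hso hs a μ haμ
    have h1 := S.sum_abs_halfClassVec_le_of_forall R v B (S.pvΔ v pv c e μ) ((a, 0) : Tau S.n) s (hPΔ a μ haμ)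
      (fun i hi => by rw [hrHalf]; exact hMt a (by omega) s hso hs i (hBU hi) (v i) (h.abs_le i hi))
    have h2 : (B.card : ℝ) * (P * DΔ) * Mt ≤ U.card * (P * DΔ) * Mt :=
      mul_le_mul_of_nonneg_right (mul_le_mul_of_nonneg_right hBc (mul_nonneg hP0 hDΔ0)) hMt0
    linarith
  · -- the inequality: the actual `|γ|` is majorised by `γb`
    intro s hso hs a μ haμ
    refine lt_of_le_of_lt ?_ (hfinal s hso hs a μ haμ)
    have hγ0 : 0 ≤ |γ| := abs_nonneg _
    have hWd0 : 0 ≤ Wd := le_trans (norm_nonneg _) (hWd i₁ (hBU hi₁B) a (by omega) 0 (by simp; positivity))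
    have hU0 : (0 : ℝ) ≤ U.card := Nat.cast_nonneg _
    have hPD : 0 ≤ (P : ℝ) * DΔ := mul_nonneg hP0 hDΔ0
    have hδ₀ : 0 ≤ δ₀ := (abs_nonneg _).trans hΛ
    have hC0 : 0 < C := by linarith
    set PD : ℝ := (P : ℝ) * DΔ with hPDdef
    gcongr

end ArchLvInv

/-! ### The level state and the schedule -/

/-- The level boxes `Lb s lev`: `2sⱼ` at level `0`, halved at each half-step. [cite: Nesterenko2003, §4 (4.1), §4.3 (4.48); shape only] -/
def Lb (s : Fin S.n → ℕ) : ℕ → Fin S.n → ℕ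
  | 0 => fun j => 2 * s j
  | lev + 1 => fun j => Lb s lev j / 2

/-- **The state at level `lev`** of the archimedean frame: a family `B ⊆ U` of unknowns `(ℓ₀, λ)` with the common integer coefficients `pv`,
RELATIVE exponents `vᵢ` injective in `λ` on `B`, a slab centre `γ` with `|γ| ≤ γb lev` and radius `wl lev` (the record's schedule: `wl (lev+1)
= wl lev / 2`, `γb (lev+1) ≥ wl lev / 2` — print's `2^{−s}` in (4.27)), and the Δ-invariant for the level-`lev` weights `Δ(2^{Ŝ−lev}Y₀; ℓ₀, H)`,
box `Lb s lev`, Δ-basis `(cl lev, el lev)`, nodes `|x| ≤ N`, order `T`. [cite: Nesterenko2003, §4 Prop. 4.1, (4.27), p. 80–88; shape only] -/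
def ArchLevelState (H Sh : ℕ) (s : Fin S.n → ℕ) (U : Finset (ℕ × (Fin S.n → ℤ))) (pv : ℕ × (Fin S.n → ℤ) → ℤ) (P : ℤ)
    (wl γb : ℕ → ℝ) (cl : ℕ → ℤ) (el : ℕ → Fin S.n → ℤ) (lev N T : ℕ) : Prop :=
  ∃ (B : Finset (ℕ × (Fin S.n → ℤ))) (v : ℕ × (Fin S.n → ℤ) → Fin S.n → ℤ) (lo : Fin S.n → ℤ) (γ : ℝ),
    B ⊆ U ∧ (∀ i ∈ B, ∀ i' ∈ B, v i = v i' ↔ i.2 = i'.2) ∧ |γ| ≤ γb lev ∧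
    S.ArchLvInv (fun i => scaledFeldR i.1 H (Sh - lev)) B v pv lo (S.Lb s lev) P (wl lev) γ (cl lev) (el lev) {x : ℤ | |x| ≤ (N : ℤ)} T

variable {S}

/-- **One level up**: `(lev, n) → (lev+1, n)` = half-step + odd-node k-step + `n − 1` k-steps, from the record packages;
keeps `B ⊆ U`, the injectivity of the exponents in `λ`, the coefficient vector and the slab. [cite: Nesterenko2003, §4 Prop. 4.1, §4.2–4.3, p. 80–95] -/
theorem levelUp {H Sh : ℕ} {s : Fin S.n → ℕ} {U : Finset (ℕ × (Fin S.n → ℤ))} {pv : ℕ × (Fin S.n → ℤ) → ℤ} {P : ℤ} {δ₀ : ℝ}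
    {wl γb : ℕ → ℝ} {cl : ℕ → ℤ} {el : ℕ → Fin S.n → ℤ} (hn : 1 ≤ S.n)
    (hind : ∀ T₁ : Finset (Fin S.n), T₁.Nonempty → ¬ IsSquare (∏ j ∈ T₁, S.α j)) (hΛ : |S.Λ / (S.b S.j₀ : ℝ)| ≤ δ₀)
    (N T : ℕ → ℕ → ℕ) (Nh : ℕ → ℕ) (lev : ℕ) (hwl : wl (lev + 1) = wl lev / 2) (hγb : wl lev / 2 ≤ γb (lev + 1))
    (hH : S.ArchHalfStepHypU (fun i => scaledFeldR i.1 H (Sh - lev)) (fun i => scaledFeldR i.1 H (Sh - (lev + 1))) U (S.Lb s lev) P (wl lev)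
      (γb lev) (cl lev) (el lev) (cl (lev + 1)) δ₀ (N lev S.n) (Nh (lev + 1)) (T lev S.n) (T (lev + 1) 0))
    (hO : S.ArchKStepOddHypU (fun i => scaledFeldR i.1 H (Sh - (lev + 1))) U (S.Lb s (lev + 1)) P (wl (lev + 1)) (γb (lev + 1))
      (cl (lev + 1)) (el (lev + 1)) δ₀ (Nh (lev + 1)) (N (lev + 1) 1) (T (lev + 1) 0) (T (lev + 1) 1))
    (hK : ∀ ν, 1 ≤ ν → ν < S.n → S.ArchKStepHypU (fun i => scaledFeldR i.1 H (Sh - (lev + 1))) U (S.Lb s (lev + 1)) P (wl (lev + 1))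
      (γb (lev + 1)) (cl (lev + 1)) (el (lev + 1)) δ₀ (N (lev + 1) ν) (N (lev + 1) (ν + 1)) (T (lev + 1) ν) (T (lev + 1) (ν + 1)))
    (hst : S.ArchLevelState H Sh s U pv P wl γb cl el lev (N lev S.n) (T lev S.n)) :
    S.ArchLevelState H Sh s U pv P wl γb cl el (lev + 1) (N (lev + 1) S.n) (T (lev + 1) S.n) := by
  classical
  obtain ⟨B, v, lo, γ, hBU, hinj, hγ, h⟩ := hst
  obtain ⟨i₀, hi₀B, _, h1⟩ := ArchLvInv.halfStep_of_hypU hBU h hind hΛ hγ hH (el (lev + 1))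
  have hB'U : S.parityClass v B i₀ ⊆ U := (S.parityClass_subset v B i₀).trans hBU
  -- the new centre is within `wl lev / 2 ≤ γb (lev+1)`, the new radius is `wl (lev+1)`, the new box is `Lb s (lev+1)`
  have hγ' : |(γ - S.Lsum (v i₀)) / 2| ≤ γb (lev + 1) := (S.abs_half_center_le v (h.slab i₀ hi₀B)).trans hγb
  have h1' : S.ArchLvInv (fun i => scaledFeldR i.1 H (Sh - (lev + 1))) (S.parityClass v B i₀) (S.halfDiff v i₀) pv
      (fun j => -((v i₀ j - lo j) / 2)) (S.Lb s (lev + 1)) P (wl (lev + 1)) ((γ - S.Lsum (v i₀)) / 2) (cl (lev + 1)) (el (lev + 1))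
      {x : ℤ | Odd x ∧ |x| ≤ 2 * (Nh (lev + 1) : ℤ) - 1} (T (lev + 1) 0) := by
    rw [hwl]; exact h1
  have h2 := ArchLvInv.levelRun hB'U hΛ hγ' (N (lev + 1)) (T (lev + 1)) (S.n - 1) hO (fun ν h0 h1 => hK ν h0 (by omega)) h1'
  rw [show 1 + (S.n - 1) = S.n by omega] at h2
  refine ⟨S.parityClass v B i₀, S.halfDiff v i₀, _, _, hB'U, ?_, hγ', h2⟩
  -- injectivity of the new exponents in `λ`
  intro i hi i' hi'
  have hiB : i ∈ B := S.parityClass_subset v B i₀ hi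
  have hi'B : i' ∈ B := S.parityClass_subset v B i₀ hi'
  have hpar : ∀ j, 2 ∣ v i j - v i₀ j := ((S.mem_parityClass v).mp hi).2
  have hpar' : ∀ j, 2 ∣ v i' j - v i₀ j := ((S.mem_parityClass v).mp hi').2
  rw [← hinj i hiB i' hi'B]
  constructor
  · intro hw
    rw [S.eq_add_two_smul_halfDiff v hpar, S.eq_add_two_smul_halfDiff v hpar', hw]
  · intro hv
    funext j; simp only [halfDiff, hv]

/-- **All the levels**: the level-`0` state at `(0, n)` and the packages for `lev < Ŝ` give the state at every `lev ≤ Ŝ`.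
[cite: Nesterenko2003, §4 Prop. 4.1, p. 80–81] -/
theorem levels {H Sh : ℕ} {s : Fin S.n → ℕ} {U : Finset (ℕ × (Fin S.n → ℤ))} {pv : ℕ × (Fin S.n → ℤ) → ℤ} {P : ℤ} {δ₀ : ℝ}
    {wl γb : ℕ → ℝ} {cl : ℕ → ℤ} {el : ℕ → Fin S.n → ℤ} (hn : 1 ≤ S.n)
    (hind : ∀ T₁ : Finset (Fin S.n), T₁.Nonempty → ¬ IsSquare (∏ j ∈ T₁, S.α j)) (hΛ : |S.Λ / (S.b S.j₀ : ℝ)| ≤ δ₀)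
    (N T : ℕ → ℕ → ℕ) (Nh : ℕ → ℕ) (hwl : ∀ lev, wl (lev + 1) = wl lev / 2) (hγb : ∀ lev, wl lev / 2 ≤ γb (lev + 1))
    (hH : ∀ lev < Sh, S.ArchHalfStepHypU (fun i => scaledFeldR i.1 H (Sh - lev)) (fun i => scaledFeldR i.1 H (Sh - (lev + 1))) U (S.Lb s lev) P
      (wl lev) (γb lev) (cl lev) (el lev) (cl (lev + 1)) δ₀ (N lev S.n) (Nh (lev + 1)) (T lev S.n) (T (lev + 1) 0))
    (hO : ∀ lev < Sh, S.ArchKStepOddHypU (fun i => scaledFeldR i.1 H (Sh - (lev + 1))) U (S.Lb s (lev + 1)) P (wl (lev + 1)) (γb (lev + 1))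
      (cl (lev + 1)) (el (lev + 1)) δ₀ (Nh (lev + 1)) (N (lev + 1) 1) (T (lev + 1) 0) (T (lev + 1) 1))
    (hK : ∀ lev < Sh, ∀ ν, 1 ≤ ν → ν < S.n → S.ArchKStepHypU (fun i => scaledFeldR i.1 H (Sh - (lev + 1))) U (S.Lb s (lev + 1)) P
      (wl (lev + 1)) (γb (lev + 1)) (cl (lev + 1)) (el (lev + 1)) δ₀ (N (lev + 1) ν) (N (lev + 1) (ν + 1)) (T (lev + 1) ν) (T (lev + 1) (ν + 1)))
    (h0 : S.ArchLevelState H Sh s U pv P wl γb cl el 0 (N 0 S.n) (T 0 S.n)) :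
    ∀ lev ≤ Sh, S.ArchLevelState H Sh s U pv P wl γb cl el lev (N lev S.n) (T lev S.n) := by
  intro lev
  induction lev with
  | zero => intro _; exact h0
  | succ lev ih =>
    intro hle
    exact levelUp hn hind hΛ N T Nh lev (hwl lev) (hγb lev) (hH lev (by omega)) (hO lev (by omega)) (hK lev (by omega)) (ih (by omega))

/-- **The k-steps of level `0`**: the START state at `(0, 0)` (all nodes `|x| ≤ N 0 0`, order `T 0 0`) and `n` symmetric k-step packages
give the level-`0` state at `(0, n)`. [cite: Nesterenko2003, §4.2 (the sets 𝒳_{0,ν}), p. 87–88] -/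
theorem levelZeroRun {H Sh : ℕ} {s : Fin S.n → ℕ} {U : Finset (ℕ × (Fin S.n → ℤ))} {pv : ℕ × (Fin S.n → ℤ) → ℤ} {P : ℤ} {δ₀ : ℝ}
    {wl γb : ℕ → ℝ} {cl : ℕ → ℤ} {el : ℕ → Fin S.n → ℤ} (hΛ : |S.Λ / (S.b S.j₀ : ℝ)| ≤ δ₀) (N T : ℕ → ℕ → ℕ)
    (hK0 : ∀ ν, ν < S.n → S.ArchKStepHypU (fun i => scaledFeldR i.1 H (Sh - 0)) U (S.Lb s 0) P (wl 0) (γb 0) (cl 0) (el 0) δ₀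
      (N 0 ν) (N 0 (ν + 1)) (T 0 ν) (T 0 (ν + 1)))
    (h00 : S.ArchLevelState H Sh s U pv P wl γb cl el 0 (N 0 0) (T 0 0)) :
    S.ArchLevelState H Sh s U pv P wl γb cl el 0 (N 0 S.n) (T 0 S.n) := by
  obtain ⟨B, v, lo, γ, hBU, hinj, hγ, h⟩ := h00
  have h1 := ArchLvInv.kchain hBU hΛ hγ (N 0) (T 0) 0 S.n (fun ν _ h1 => hK0 ν (by omega)) (by simpa using h)
  exact ⟨B, v, lo, γ, hBU, hinj, hγ, by simpa using h1⟩

/-- **The frame output from the schedule**: the last level's state gives `FrameOutputTwo n α b j₀ D₀ S₀ X′ (Lb s Ŝ)` when the unknowns have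
`Y₀`-degree `≤ D₀`, `(n+1)X′ ≤ N`, `(n+1)S₀ < T`. [cite: Nesterenko2003, §5.1 (5.1)–(5.4), p. 95–97] -/
theorem frameOutput_of_levelState {H Sh D₀ : ℕ} {s : Fin S.n → ℕ} {U : Finset (ℕ × (Fin S.n → ℤ))} {pv : ℕ × (Fin S.n → ℤ) → ℤ}
    {P : ℤ} {wl γb : ℕ → ℝ} {cl : ℕ → ℤ} {el : ℕ → Fin S.n → ℤ} {N T X' S₀ : ℕ}
    (hst : S.ArchLevelState H Sh s U pv P wl γb cl el Sh N T) (hU : ∀ i ∈ U, i.1 ≤ D₀)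
    (hX : (S.n + 1) * X' ≤ N) (hS : (S.n + 1) * S₀ < T) :
    GenThreeFrameSpecTwo.FrameOutputTwo S.n S.α S.b S.j₀ D₀ S₀ X' (S.Lb s Sh) := by
  classical
  obtain ⟨B, v, lo, γ, hBU, hinj, _, h⟩ := hst
  have h' : S.ArchLvInv (fun i => feldR i.1 H) B v pv lo (S.Lb s Sh) P (wl Sh) γ (cl Sh) (el Sh) {x : ℤ | |x| ≤ (N : ℤ)} T := by
    refine h.congr_R fun i _ t x => ?_
    rw [Nat.sub_self, hasse_scaledFeldR_eval]
    simp
  exact h'.frameOutputTwo (fun i hi => hU i (hBU hi)) hinj hX hS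

/-- **THE LEVELS OF THE ARCHIMEDEAN FRAME** (the content of `stub_levelsArch`, R27): the START state at `(0,0)`, all record packages
(level-`0` k-steps; for each `lev < Ŝ` the half-step, the odd-node step and the `n − 1` k-steps), independent square classes and the
negated bound `|Λ/b_{j₀}| ≤ δ₀` give the place-free frame output `FrameOutputTwo n α b j₀ D₀ S₀ X′ (Lb s Ŝ)` of the last level.
[cite: Nesterenko2003, §4 Prop. 4.1, §5.1, p. 80–97] -/
theorem frameOutput_of_schedule {H Sh D₀ : ℕ} {s : Fin S.n → ℕ} {U : Finset (ℕ × (Fin S.n → ℤ))} {pv : ℕ × (Fin S.n → ℤ) → ℤ}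
    {P : ℤ} {δ₀ : ℝ} {wl γb : ℕ → ℝ} {cl : ℕ → ℤ} {el : ℕ → Fin S.n → ℤ} (hn : 1 ≤ S.n)
    (hind : ∀ T₁ : Finset (Fin S.n), T₁.Nonempty → ¬ IsSquare (∏ j ∈ T₁, S.α j)) (hΛ : |S.Λ / (S.b S.j₀ : ℝ)| ≤ δ₀)
    (N T : ℕ → ℕ → ℕ) (Nh : ℕ → ℕ) (hwl : ∀ lev, wl (lev + 1) = wl lev / 2) (hγb : ∀ lev, wl lev / 2 ≤ γb (lev + 1))
    (hK0 : ∀ ν, ν < S.n → S.ArchKStepHypU (fun i => scaledFeldR i.1 H (Sh - 0)) U (S.Lb s 0) P (wl 0) (γb 0) (cl 0) (el 0) δ₀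
      (N 0 ν) (N 0 (ν + 1)) (T 0 ν) (T 0 (ν + 1)))
    (hH : ∀ lev < Sh, S.ArchHalfStepHypU (fun i => scaledFeldR i.1 H (Sh - lev)) (fun i => scaledFeldR i.1 H (Sh - (lev + 1))) U (S.Lb s lev) P
      (wl lev) (γb lev) (cl lev) (el lev) (cl (lev + 1)) δ₀ (N lev S.n) (Nh (lev + 1)) (T lev S.n) (T (lev + 1) 0))
    (hO : ∀ lev < Sh, S.ArchKStepOddHypU (fun i => scaledFeldR i.1 H (Sh - (lev + 1))) U (S.Lb s (lev + 1)) P (wl (lev + 1)) (γb (lev + 1))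
      (cl (lev + 1)) (el (lev + 1)) δ₀ (Nh (lev + 1)) (N (lev + 1) 1) (T (lev + 1) 0) (T (lev + 1) 1))
    (hK : ∀ lev < Sh, ∀ ν, 1 ≤ ν → ν < S.n → S.ArchKStepHypU (fun i => scaledFeldR i.1 H (Sh - (lev + 1))) U (S.Lb s (lev + 1)) P
      (wl (lev + 1)) (γb (lev + 1)) (cl (lev + 1)) (el (lev + 1)) δ₀ (N (lev + 1) ν) (N (lev + 1) (ν + 1)) (T (lev + 1) ν) (T (lev + 1) (ν + 1)))
    (h00 : S.ArchLevelState H Sh s U pv P wl γb cl el 0 (N 0 0) (T 0 0))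
    (hU : ∀ i ∈ U, i.1 ≤ D₀) {X' S₀ : ℕ} (hX : (S.n + 1) * X' ≤ N Sh S.n) (hS : (S.n + 1) * S₀ < T Sh S.n) :
    GenThreeFrameSpecTwo.FrameOutputTwo S.n S.α S.b S.j₀ D₀ S₀ X' (S.Lb s Sh) :=
  frameOutput_of_levelState (levels hn hind hΛ N T Nh hwl hγb hH hO hK (levelZeroRun hΛ N T hK0 h00) Sh le_rfl) hU hX hS

end ArchG3Setup

end Summit.ABC.StewartYu

end
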